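import Summits.AtomisticToContinuum.FouriersLaw.Theorems.BondHeatUncertaintyBoundedResponseTransientBandD

/-!
# `TransientBand` — the blocker `BoundedResponse` (11071) split at the Thouless time by the escape transient (lens-1 g92 node B) — part 5 of 5 (sequel of `…BondHeatUncertaintyBoundedResponseTransientBandD`)

Split for the 400-line cap by the landing lane (hand-2 g35); the module docstring of part 1 (`…BondHeatUncertaintyBoundedResponseTransientBandA`) describes the whole node.  Same namespace; all FQNs unchanged.
0 sorry; standard axioms.
-/

noncomputable section
open MeasureTheory Filter Topology Set
open Literature.MathematicalPhysics.KineticTheory.HeatConduction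

namespace Summit.AtomisticToContinuum.FouriersLaw.Theorems.BoundedResponse.TransientBand

open Summit.AtomisticToContinuum.FouriersLaw.Theses.BondHeatUncertainty (BoundedResponse)
open Summit.AtomisticToContinuum.FouriersLaw.Theses.GriffithsLimitExchange (BoundaryDEP)
open Summit.AtomisticToContinuum.FouriersLaw.Theorems.SubdiffusiveBondHeat
  (boundaryKernelBasics_proof pinnedChain_primitive_kinKernel_integral_eq escapeDeficit_nonneg escapeDeficit_le_one
    boundedResponse_iff_ohmicFloor)
open Summit.AtomisticToContinuum.FouriersLaw.Theorems.SubdiffusiveBondHeat.EscapeGrading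
  (escapeDeficit OhmicFloor ExponentFloor ohmicFloor_iff_boundedResponse exponentFloor_one_iff_ohmicFloor)
open Summit.AtomisticToContinuum.FouriersLaw.Theorems.BoundedResponse.TransientContact (contactImbalanceCorr)
open Summit.AtomisticToContinuum.FouriersLaw.Theorems.SubdiffusiveBondHeat

/-! ### The escape kernel on the frequency side -/

/-- The **Warburg dip** of the boundary noise spectrum, VERBATIM the tree's `M_N(ω) = (γ/T²)∫_{(0,∞)} (1 − cos ωu) K_N(u) du`
(`warburgDip_le_one`, `transientEW_of_contactWarburgModulus`) over `escapeKernel`. [folklore] -/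
def warburgDip (ω₂ lam β γ T : ℝ) (N : ℕ) (ω : ℝ) : ℝ :=
  γ / T ^ 2 * ∫ u in Ioi 0, (1 - Real.cos (ω * u)) * escapeKernel ω₂ lam β γ T N u

section FixedNSpectral

variable {ω₂ lam β γ T : ℝ} (hω : 0 < ω₂) (hl : 0 < lam) (hβ : 0 < β) (hγ : 0 < γ) (hT : 0 < T)
include hω hl hβ hγ hT

/-- **Spectral representation of the overshoot**: `c₁ · Ov_N(t) = ∫_{(0,∞)} (1 − cos ωt) ω⁻² M_N(ω) dω` for `t ≥ 0`
(every `N`). [folklore] -/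
theorem escapeTransient_eq_spectral (N : ℕ) {t : ℝ} (ht : 0 ≤ t) :
    (∫ ω in Ioi (0 : ℝ), (1 - Real.cos ω) / ω ^ 2) * escapeTransient ω₂ lam β γ T N t =
      ∫ ω in Ioi (0 : ℝ), (1 - Real.cos (ω * t)) / ω ^ 2 * warburgDip ω₂ lam β γ T N ω := by
  have h := integral_min_mul_eq_spectral (continuous_escapeKernel hω hl hβ hγ hT N).measurable
    (integrableOn_escapeKernel hω hl hβ hγ hT N) ht
  unfold escapeTransient warburgDip
  calc (∫ ω in Ioi (0 : ℝ), (1 - Real.cos ω) / ω ^ 2) *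
        (γ / T ^ 2 * ∫ u in Ioi 0, min u t * escapeKernel ω₂ lam β γ T N u)
        = γ / T ^ 2 * ((∫ ω in Ioi (0 : ℝ), (1 - Real.cos ω) / ω ^ 2) *
            ∫ u in Ioi 0, min u t * escapeKernel ω₂ lam β γ T N u) := by ring
    _ = γ / T ^ 2 * ∫ ω in Ioi (0 : ℝ), (1 - Real.cos (ω * t)) / ω ^ 2 *
            ∫ u in Ioi 0, (1 - Real.cos (ω * u)) * escapeKernel ω₂ lam β γ T N u := by rw [h]
    _ = ∫ ω in Ioi (0 : ℝ), γ / T ^ 2 * ((1 - Real.cos (ω * t)) / ω ^ 2 *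
            ∫ u in Ioi 0, (1 - Real.cos (ω * u)) * escapeKernel ω₂ lam β γ T N u) := by
          rw [integral_const_mul]
    _ = _ := by
          refine integral_congr_ae (Eventually.of_forall fun ω => ?_)
          simp only
          ring

/-- Fejér positivity of the escape kernel (the tree's `lagIntegral_cos_kinCorr_nonneg` over `escapeKernel`). [folklore] -/
theorem escapeKernel_lagIntegral_cos_nonneg (N : ℕ) (ω : ℝ) {t : ℝ} (ht : 0 ≤ t) :
    0 ≤ ∫ r in (0 : ℝ)..t, (t - r) * (Real.cos (ω * r) * escapeKernel ω₂ lam β γ T N r) :=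
  lagIntegral_cos_kinCorr_nonneg ω₂ lam β γ hω hl hβ hγ T hT N ω t ht

/-- **The high band of the overshoot is free**, uniformly in `N` and `t ≥ 0`:
`∫_{(1,∞)} (1 − cos ωt) ω⁻² D_{K_N}(ω) dω ≥ −32 c₁ T²` (Bochner positivity of `K_N` + `|K_N| ≤ 2T²`). [folklore] -/
theorem escapeHighBand_ge (N : ℕ) {t : ℝ} (ht : 0 ≤ t) :
    -(16 * (∫ ω in Ioi (0 : ℝ), (1 - Real.cos ω) / ω ^ 2) * (2 * T ^ 2)) ≤
      ∫ ω in Ioi 1, (1 - Real.cos (ω * t)) / ω ^ 2 *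
        ∫ u in Ioi 0, (1 - Real.cos (ω * u)) * escapeKernel ω₂ lam β γ T N u :=
  highBand_spectral_ge (continuous_escapeKernel hω hl hβ hγ hT N).measurable
    (integrableOn_escapeKernel hω hl hβ hγ hT N) (abs_escapeKernel_le hω hl hβ hγ hT N)
    (fun ω _ ht => escapeKernel_lagIntegral_cos_nonneg hω hl hβ hγ hT N ω ht) ht

/-- **Infrared floor ⟹ overshoot floor** at fixed `N`: if `M_N(ω) ≥ −A√ω` on `(0,1]`, then for `t ≥ 1`
`Ov_N(t) ≥ −(γ/T²)((max (A·T²/γ) 0)·c₂ + 32c₁T²)/c₁ · √t`. [folklore] -/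
theorem escapeTransient_ge_of_dipFloor (N : ℕ) {A t : ℝ} (ht : 1 ≤ t)
    (hF : ∀ ω : ℝ, 0 < ω → ω ≤ 1 → -(A * Real.sqrt ω) ≤ warburgDip ω₂ lam β γ T N ω) :
    -(γ / T ^ 2 * ((max (A * T ^ 2 / γ) 0 * (∫ v in Ioi (0 : ℝ), (1 - Real.cos v) / (v * Real.sqrt v)) +
        max (16 * (∫ ω in Ioi (0 : ℝ), (1 - Real.cos ω) / ω ^ 2) * (2 * T ^ 2)) 0) /
        (∫ ω in Ioi (0 : ℝ), (1 - Real.cos ω) / ω ^ 2) * Real.sqrt t)) ≤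
      escapeTransient ω₂ lam β γ T N t := by
  have hγT : 0 < γ / T ^ 2 := by positivity
  have hF' : ∀ ω : ℝ, 0 < ω → ω ≤ 1 →
      -(A * T ^ 2 / γ * Real.sqrt ω) ≤ ∫ u in Ioi 0, (1 - Real.cos (ω * u)) * escapeKernel ω₂ lam β γ T N u := by
    intro ω hω0 hω1
    have h := hF ω hω0 hω1
    unfold warburgDip at h
    have key : γ / T ^ 2 * (-(A * T ^ 2 / γ * Real.sqrt ω)) = -(A * Real.sqrt ω) := by
      field_simp
    rw [← mul_le_mul_iff_of_pos_left hγT, key]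
    exact h
  have h := integral_min_mul_ge_of_floor (continuous_escapeKernel hω hl hβ hγ hT N).measurable
    (integrableOn_escapeKernel hω hl hβ hγ hT N) ht hF' (escapeHighBand_ge hω hl hβ hγ hT N (zero_le_one.trans ht))
  unfold escapeTransient
  rw [neg_le, ← mul_neg]
  rw [neg_le] at h
  exact mul_le_mul_of_nonneg_left h hγT.le

end FixedNSpectral

/-- **`WarburgDipNonneg`** — «the boundary noise spectrum PEAKS AT DC»: `M_N(ω) ≥ 0` for all parameters, `T > 0`, `N`, `ω`
(fixed-`N`, no `N`-uniform constant).  ⟸ `BoundaryDEP` trivially (`K_N ≥ 0 ⇒ (1 − cos)·K_N ≥ 0`); TRUE for phonons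
(`K_N^{harm} = 2⟨p₀p₀(u)⟩² ≥ 0`); STRICTLY WEAKER than `BoundaryDEP` as a statement about `K_N` (a kernel with negative
excursions whose cosine transform is still maximal at `ω = 0` satisfies it).  Gives `Ov_N(t) ≥ 0` at ALL times, hence every
`TransientFloor g` and `DeficitCesaroFloor` with constant `0`.  Why it might fail: an under-damped boundary mode (small `γ`, or the
optical band edge `2ω_max`) could move the maximum of the `p₀² − T` spectrum away from DC once anharmonic scattering makes `K_N`
sign-changing. (piece · rung) [route statement · this cell; NOT a literature fact] -/
def WarburgDipNonneg : Prop :=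
  ∀ ω₂ lam β γ : ℝ, 0 < ω₂ → 0 < lam → 0 < β → 0 < γ → ∀ T : ℝ, 0 < T → ∀ (N : ℕ) (ω : ℝ),
    0 ≤ warburgDip ω₂ lam β γ T N ω

/-- **`WarburgDipFloor`** — the LOWER one-sided Warburg cusp, `N`-uniformly: `∃ A N₀ ∀ N ≥ N₀ ∀ |ω| ≤ 1, M_N(ω) ≥ −A√|ω|`
(the boundary noise spectrum rises above its DC value by at most a `√|ω|` cusp: `s_N(ω) ≤ s_N(0) + (2T²/γ)A√|ω|`).  The
mirror image of `WarburgDipCusp`; phonon-true with `A = 0`; ⟸ `WarburgDipNonneg`; ⟹ `TransientFloor 1`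
(`transientFloor_one_of_warburgDipFloor`, the high band being free).  Why it might fail: as for (F₁) — it is (F₁) read
frequency by frequency. (piece · rung) [route statement · this cell; NOT a literature fact] -/
def WarburgDipFloor : Prop :=
  ∀ ω₂ lam β γ : ℝ, 0 < ω₂ → 0 < lam → 0 < β → 0 < γ → ∀ T : ℝ, 0 < T →
    ∃ A : ℝ, ∃ N₀ : ℕ, ∀ N : ℕ, N₀ ≤ N → ∀ ω : ℝ, |ω| ≤ 1 →
      -(A * Real.sqrt |ω|) ≤ warburgDip ω₂ lam β γ T N ω

/-- **`WarburgDipCusp`** — the UPPER one-sided Warburg cusp, VERBATIM the strategist's `ContactWarburgModulus` of crux 9120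
(`STRATEGY-CENSUS.md` §Strengthen; hypothesis of the LANDED `transientEW_of_contactWarburgModulus`) over `escapeKernel`:
`∃ C N₀ ∀ N ≥ N₀ ∀ |ω| ≤ 1, M_N(ω) ≤ C√|ω|`.  UNDECIDED; carries the Edwards–Wilkinson half of (S); here only used for the
converse-side ceiling (U). (piece · rung) [route statement · this cell; NOT a literature fact] -/
def WarburgDipCusp : Prop :=
  ∀ ω₂ lam β γ : ℝ, 0 < ω₂ → 0 < lam → 0 < β → 0 < γ → ∀ T : ℝ, 0 < T →
    ∃ C : ℝ, ∃ N₀ : ℕ, ∀ N : ℕ, N₀ ≤ N → ∀ ω : ℝ, |ω| ≤ 1 →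
      warburgDip ω₂ lam β γ T N ω ≤ C * Real.sqrt |ω|

/-- `BoundaryDEP ⟹ WarburgDipNonneg` (pointwise `K_N ≥ 0` makes every dip integrand nonnegative). [folklore] -/
theorem warburgDipNonneg_of_boundaryDEP : BoundaryDEP → WarburgDipNonneg := by
  intro hDEP ω₂ lam β γ hω hl hβ hγ T hT N ω
  unfold warburgDip
  refine mul_nonneg (by positivity) (setIntegral_nonneg measurableSet_Ioi fun u hu => ?_)
  have hK : 0 ≤ escapeKernel ω₂ lam β γ T N u := by
    have h := (hDEP ω₂ lam β γ hω hl hβ hγ T hT N u (le_of_lt hu)).1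
    simpa only [escapeKernel] using h
  exact mul_nonneg (one_sub_cos_mem_Icc (ω * u)).1 hK

/-- **`WarburgDipNonneg ⟹ Ov_N(t) ≥ 0` for every `t ≥ 0`** (spectral representation + `c₁ > 0`). [folklore] -/
theorem escapeTransient_nonneg_of_warburgDipNonneg (h : WarburgDipNonneg) :
    ∀ ω₂ lam β γ : ℝ, 0 < ω₂ → 0 < lam → 0 < β → 0 < γ → ∀ T : ℝ, 0 < T → ∀ (N : ℕ) (t : ℝ), 0 ≤ t →
      0 ≤ escapeTransient ω₂ lam β γ T N t := by
  intro ω₂ lam β γ hω hl hβ hγ T hT N t ht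
  have hid := escapeTransient_eq_spectral hω hl hβ hγ hT N ht
  have hrhs : 0 ≤ ∫ ω in Ioi (0 : ℝ), (1 - Real.cos (ω * t)) / ω ^ 2 * warburgDip ω₂ lam β γ T N ω :=
    setIntegral_nonneg measurableSet_Ioi fun ω _ =>
      mul_nonneg (div_nonneg (one_sub_cos_mem_Icc (ω * t)).1 (sq_nonneg _)) (h ω₂ lam β γ hω hl hβ hγ T hT N ω)
  rw [← hid] at hrhs
  exact (mul_nonneg_iff_of_pos_left integral_one_sub_cos_div_sq_pos).mp hrhs

/-- **`WarburgDipNonneg ⟹ TransientFloor g` for EVERY grade `g`** (constant `0`). [folklore] -/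
theorem transientFloor_of_warburgDipNonneg (g : ℝ) (h : WarburgDipNonneg) : TransientFloor g := by
  intro ω₂ lam β γ hω hl hβ hγ T hT c hc
  refine ⟨0, 0, fun N _ => ?_⟩
  have h0 := escapeTransient_nonneg_of_warburgDipNonneg h ω₂ lam β γ hω hl hβ hγ T hT N (c * (N : ℝ) ^ 2) (by positivity)
  simpa using h0

/-- **`WarburgDipNonneg ⟹ DeficitCesaroFloor`** (constant `0`: `W_N = tE_N + Ov_N ≥ 0`, `E_N ≥ 0` landed for `N ≥ 2`). [folklore] -/
theorem deficitCesaroFloor_of_warburgDipNonneg (h : WarburgDipNonneg) : DeficitCesaroFloor := by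
  intro ω₂ lam β γ hω hl hβ hγ T hT c hc
  refine ⟨0, 2, fun N hN => ?_⟩
  have ht : (0 : ℝ) ≤ c * (N : ℝ) ^ 2 := by positivity
  have h0 := escapeTransient_nonneg_of_warburgDipNonneg h ω₂ lam β γ hω hl hβ hγ T hT N (c * (N : ℝ) ^ 2) ht
  have hE := escapeDeficit_nonneg ω₂ lam β γ hω hl hβ hγ T hT N hN
  rw [deficitCesaro_eq_add hω hl hβ hγ hT N ht]
  have : 0 ≤ c * (N : ℝ) ^ 2 * escapeDeficit ω₂ lam β γ T N := mul_nonneg ht hE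
  simp only [zero_mul, neg_zero]
  linarith

/-- `WarburgDipNonneg ⟹ WarburgDipFloor` (with `A = 0`). [folklore] -/
theorem warburgDipFloor_of_warburgDipNonneg (h : WarburgDipNonneg) : WarburgDipFloor := by
  intro ω₂ lam β γ hω hl hβ hγ T hT
  exact ⟨0, 0, fun N _ ω _ => by simpa using h ω₂ lam β γ hω hl hβ hγ T hT N ω⟩

/-- **The lower Warburg cusp gives the floor: `WarburgDipFloor ⟹ TransientFloor 1`** — the infrared hypothesis on `(0,1]`,
the free high band (`escapeHighBand_ge`) and the spectral representation, at `t = cN² ≥ 1`. [folklore] -/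
theorem transientFloor_one_of_warburgDipFloor (h : WarburgDipFloor) : TransientFloor 1 := by
  intro ω₂ lam β γ hω hl hβ hγ T hT c hc
  obtain ⟨A, N₀, hA⟩ := h ω₂ lam β γ hω hl hβ hγ T hT
  set c₁ : ℝ := ∫ ω in Ioi (0 : ℝ), (1 - Real.cos ω) / ω ^ 2 with hc₁
  set c₂ : ℝ := ∫ v in Ioi (0 : ℝ), (1 - Real.cos v) / (v * Real.sqrt v) with hc₂
  set L : ℝ := γ / T ^ 2 * ((max (A * T ^ 2 / γ) 0 * c₂ + max (16 * c₁ * (2 * T ^ 2)) 0) / c₁ * Real.sqrt c)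
    with hL
  refine ⟨L, max N₀ (⌈1 / Real.sqrt c⌉₊ + 1), fun N hN => ?_⟩
  have hN₀ : N₀ ≤ N := le_trans (le_max_left _ _) hN
  have hN1 : ⌈1 / Real.sqrt c⌉₊ + 1 ≤ N := le_trans (le_max_right _ _) hN
  have hsc : 0 < Real.sqrt c := Real.sqrt_pos.2 hc
  have hNr : 1 / Real.sqrt c < (N : ℝ) := by
    have h' : (⌈1 / Real.sqrt c⌉₊ : ℝ) + 1 ≤ N := by exact_mod_cast hN1
    linarith [Nat.le_ceil (1 / Real.sqrt c)]
  have hNpos : (0 : ℝ) < N := lt_trans (by positivity) hNr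
  have ht1 : (1 : ℝ) ≤ c * (N : ℝ) ^ 2 := by
    have h1 : 1 < Real.sqrt c * N := by rwa [div_lt_iff₀ hsc, mul_comm] at hNr
    have h2 : (Real.sqrt c * N) ^ 2 = c * (N : ℝ) ^ 2 := by rw [mul_pow, Real.sq_sqrt hc.le]
    nlinarith
  have hF : ∀ ω : ℝ, 0 < ω → ω ≤ 1 → -(A * Real.sqrt ω) ≤ warburgDip ω₂ lam β γ T N ω := by
    intro ω hω0 hω1
    have h := hA N hN₀ ω (by rw [abs_of_pos hω0]; exact hω1)
    rwa [abs_of_pos hω0] at h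
  have h := escapeTransient_ge_of_dipFloor hω hl hβ hγ hT N ht1 hF
  have hsq : Real.sqrt (c * (N : ℝ) ^ 2) = Real.sqrt c * N := by
    rw [Real.sqrt_mul hc.le, Real.sqrt_sq hNpos.le]
  rw [hsq] at h
  have hLN : L * (N : ℝ) ^ (1 : ℝ) = γ / T ^ 2 * ((max (A * T ^ 2 / γ) 0 * c₂ +
      max (16 * c₁ * (2 * T ^ 2)) 0) / c₁ * (Real.sqrt c * N)) := by
    rw [Real.rpow_one, hL]; ring
  rw [hLN]
  exact h

/-- **The upper Warburg cusp gives the ceiling: `WarburgDipCusp ⟹ TransientCeilingPoint`** — by the LANDED transfer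
`transientEW_of_contactWarburgModulus` (9120's line) and `transientCeilingPoint_of_transientEW`. [folklore] -/
theorem transientCeilingPoint_of_warburgDipCusp (h : WarburgDipCusp) : TransientCeilingPoint :=
  transientCeilingPoint_of_transientEW (transientEW_of_contactWarburgModulus h)

/-- **Under the two-sided `N`-uniform Warburg modulus of the boundary noise spectrum at DC, `BoundedResponse` (11071) is
EXACTLY Edwards–Wilkinson at the Thouless time**: `WarburgDipFloor → WarburgDipCusp → (BoundedResponse ↔ DeficitCesaroPoint)`.
[folklore] -/
theorem boundedResponse_iff_deficitCesaroPoint_of_warburgModulus (hF : WarburgDipFloor) (hC : WarburgDipCusp) :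
    BoundedResponse ↔ DeficitCesaroPoint :=
  boundedResponse_iff_deficitCesaroPoint (transientFloor_one_of_warburgDipFloor hF)
    (transientCeilingPoint_of_warburgDipCusp hC)

/-- **The spectral sign rung closes the floor side outright**: `DeficitCesaroPoint → WarburgDipNonneg → BoundedResponse`,
and hence `DeficitCesaroPoint → BoundaryDEP → BoundedResponse` factors through the spectrum. [folklore] -/
theorem boundedResponse_of_deficitCesaroPoint_warburgDipNonneg (hD : DeficitCesaroPoint) (h : WarburgDipNonneg) :
    BoundedResponse :=
  boundedResponse_of_deficitCesaroPoint_transientFloor hD (transientFloor_of_warburgDipNonneg 1 h)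

end Summit.AtomisticToContinuum.FouriersLaw.Theorems.BoundedResponse.TransientBand

end
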